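/-
Copyright: statement-level skeleton of a published paper (lit-balaban cell, Phase-2 proof seat p39 gen 8). No proof claims
beyond what the kernel checks below.
-/
import Literature.MathematicalPhysics.QuantumFieldTheory.Balaban1983to89.B3CxiLatticePairSums
import Literature.MathematicalPhysics.QuantumFieldTheory.Balaban1983to89.B3TorusKernelUnfolding
import Literature.MathematicalPhysics.QuantumFieldTheory.Balaban1983to89.B3Eq329WardVanishing
import Literature.MathematicalPhysics.QuantumFieldTheory.Balaban1983to89.B3Pi2CrossTermsZeroTorus

/-!
# B3 — T. Bałaban, *(Higgs)₂,₃ quantum fields in a finite volume. III. Renormalization*, CMP **88** (1983) 411–445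
[Balaban1983Higgs3], p. 442 [PDF 32], the sentence after (3.30): *"where the coefficient at the vertex [Π_{μμ′ν}] is bounded, and
the coefficient at the vertex [Π_{μμ′}] is proportional to (L^{j₀}η)^{−d+2}"* — the `Π_{μμ′}` HALF at the zero-field TORUS instance
(`d = 3`): (A) the FINITE-VOLUME DEFECT of the Ward–Takahashi vanishing of (3.29) — `|Π_{μμ′}[C^ξ_T, C^ξ_T, C^ξ_T](y)| ≤
Cst·|tr q²|·e^{−ξN/8}` uniformly in the spacing `0 < ξ ≤ 1` and the period `ξN ≥ 1`; (B) hence `|Π^{(ξ)}_{μμ′}[G^ξ_k(0)](y)| ≤ Cst·|tr q²|`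
for all volumes and all `1 ≤ k ≤ K` — the RESCALED coefficient is bounded, i.e. (r15's `Pi2_rescale`) the η-lattice coefficient is
`(L^{j₀}η)^{−1}` times a bounded function

statement-level skeleton of published theorems with citation tags; proofs where landed; nothing here is a claim about
the Yang–Mills mass gap

PDF held: `paper:balaban1983-higgs-2-3-quantum-fields-finite-volume` (journal page = PDF page + 410); pp. 440–442 [PDF 30–32] read on
the ×2 renders `run/shared/lean/pub/pub-balaban/b2b-balaban-ref1/pages/1983-cmp88-higgs23-III/1983-cmp88-higgs23-III-p030-x2.png` …
`-p032-x2.png`.  Row **B3.Eq3.25-3.32** of `HOME/lit-balaban-r15/ROWS-B3.md` (fold owner r15).  CONTEXT.  The paper proves on p. 442 that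
the pure-`C^ξ` function `Π_{μμ′}` of the square bracket of (3.26) VANISHES by the Ward–Takahashi identity (2.26) — PROVED on the
infinite lattice ξℤ^d by seat p20 (`B3Eq329WardVanishing.Pi2Z_Cxi_eq_zero`), and REFUTED verbatim on a finite torus by p20's kernel
witness `B3Eq329TorusCounterexample` (GAPS.md G-B3-08: on the torus the momentum integral is a Riemann sum and the λ of p. 442 is not
periodic).  THIS FILE quantifies G-B3-08: on the torus of the model the same function is NOT zero but EXPONENTIALLY SMALL in the
period, uniformly in the spacing — by UNFOLDING the torus `x′`-sum (`B3TorusKernelUnfolding.sum_tsum_cosetPt_mul_eq`): the `k = 0`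
term of `Σ_{k∈ℤ³}` IS p20's `Pi2Z … 0 = 0`, the `k ≠ 0` wrap-around terms are `O(e^{−ξN|k|_∞/4})` (`B3CxiLatticePairSums.pair_shift_bound`,
after the ℤ³ summation by parts `tsum_Cxi_mul_d2_eq` that trades `C^ξ·(∂_{μ′}C^ξ∂^*_μ)` for `(∂_{μ′}C^ξ)·(C^ξ∂^*_μ)`).  Combined with
seat p39 gen 7's `B3Pi2CrossTermsZeroTorus.Pi2_G0xi_sub_CxiT` (`|Π[G^ξ_k(0)] − Π[C^ξ_T]| ≤ Cst|tr q²|`) this gives the `Π_{μμ′}` half of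
the quoted sentence at the zero-field torus instance.
WHAT IS PROVED (`T = Site P j`, `N = P.sitesPerDir j`, `P.d = 3`, `C^ξ_T = B3CxiTorusBound.CxiT ξ`, `Π = B3Sect3VectorSelfEnergy.Pi2`):
* §1 the two nonlocal graphs and the two local terms of `Π_{μμ′}[C^ξ_T]` UNFOLDED: `sumA_unfold`, `sumB_unfold` (`Σ_{x′}` of the torus
  kernels = `Σ'_kΣ'_w` of the ξℤ³ kernels), with the summability of the unfolded families.
* §2 the `k = 0` term is p20's `Pi2Z 3 ξ τ C^ξ μ μ′ 0` (`Pi2Z_zero_eq_unfold`), hence `0`.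
* §3 **`abs_Pi2_CxiT_le`** (A): `|Π_{μμ′}[C^ξ_T,C^ξ_T,C^ξ_T](y)| ≤ 6·10¹⁵·|τ|·e^{−ξN/8}` for `0 < ξ ≤ 1`, `1 ≤ ξN`, all `μ, μ′, y, τ = tr q²`.
* §4 **`abs_Pi2_G0xi_le`** (B): `∃ Cst` (a function of `L, a, m²`) with `|Π_{μμ′}[G^ξ_k(0),G^ξ_k(0),G^ξ_k(0)](y)| ≤ Cst·|tr q²|` for every
  `P = (3, L, m, K)`, `1 ≤ k ≤ K`, `μ, μ′, y` (zero-field torus instance `B3GkZeroTorusRescaled.G0xi`, `ξ = L^{−k}` lattice `Site P 0`).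
HONEST SCOPE: zero external field, whole torus, `d = 3`; the η-lattice factor `(L^{j₀}η)^{−d+2}` is r15's PROVED rescaling identity
`Pi2_rescale` and is not re-derived; (3.30)'s subtraction pictures and the `Π_{μμ′ν}` half (file `B3Pi3CxiTorusBounded`) are not here.
Mathlib + the cited tree files only; theorems only, no definitions, no named facts; standard axioms.  Unit `lit-balaban-p39-g8`
(Phase-2 proof seat p39, gen 8), HOME `run/shared/lean/pub/lit-balaban/`, 2026-08-21.
-/

open scoped BigOperators

namespace Literature.MathematicalPhysics.QuantumFieldTheory.Balaban1983to89.B3Pi2CxiTorusBounded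

open B3Sect3VectorSelfEnergy B3Sect3ScalarSelfEnergy B3CxiPropagator B3CxiTorusBound B3CxiUniformBound
  B3ZdLatticeProfileSums B3TorusKernelUnfolding B3CxiLatticePairSums B3Eq329WardVanishing LatticeFieldCalculus

noncomputable section

variable {P : Params} {j : ℕ} {ξ : ℝ}

/-! ## §1 The graphs of `Π_{μμ′}[C^ξ_T]` unfolded -/

/-- kernel: signed summability of an unfolded pair family from the absolute one. [cite: Balaban1983Higgs3, (3.27) p.441] -/
private theorem summable_signed {f g : ZSite P.d → ℝ} {N : ℕ}
    (h : Summable fun pr : ZSite P.d × ZSite P.d => |f pr.1| * |g ((N : ℤ) • pr.2 - pr.1)|) :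
    Summable fun pr : ZSite P.d × ZSite P.d => f pr.1 * g ((N : ℤ) • pr.2 - pr.1) :=
  Summable.of_abs (h.congr fun pr => by rw [← abs_mul])

/-- **The first graph unfolded**: `Σ_{x′∈T} (C^ξ_T∂^{ξ*}_{μ′})(y,x′)(C^ξ_T∂^{ξ*}_μ)(x′,y) = Σ'_{k}Σ'_{w} (∂^{ξ*}_{μ′}C^ξ)(w)(∂^{ξ*}_μC^ξ)(N·k − w)`
(`0 < ξ ≤ 1`, `ξN ≥ 1`, `d = 3`). [cite: Balaban1983Higgs3, (3.26) p.440] -/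
theorem sumA_unfold (hd : P.d = 3) (hξ : 0 < ξ) (hξ1 : ξ ≤ 1) (hN : 1 ≤ ξ * (P.sitesPerDir j : ℝ)) (μ μ' : Fin P.d)
    (y : Site P j) :
    ∑ x' : Site P j, dAdjKernel ξ⁻¹ μ' (CxiT ξ) y x' * dAdjKernel ξ⁻¹ μ (CxiT ξ) x' y =
      ∑' k : ZSite P.d, ∑' w : ZSite P.d,
        pdiffAdjZ ξ⁻¹ μ' (Cxi P.d ξ) w * pdiffAdjZ ξ⁻¹ μ (Cxi P.d ξ) ((P.sitesPerDir j : ℤ) • k - w) := by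
  have hS := summable_pair_family hd hξ hξ1 hN (by norm_num) (by norm_num) le_rfl le_rfl _ _
    (abs_pdiffAdjZ_Cxi_le_profile hd hξ hξ1 μ') (abs_pdiffAdjZ_Cxi_le_profile hd hξ hξ1 μ)
  simp_rw [dAdjKernel_CxiT_eq_tsum hξ]
  exact sum_tsum_cosetPt_mul_eq_one y _ _ (summable_signed hS)

/-- **The second graph unfolded**: `Σ_{x′∈T} C^ξ_T(y,x′)(∂^ξ_{μ′}C^ξ_T∂^{ξ*}_μ)(x′,y) = Σ'_{k}Σ'_{w} C^ξ(w)(∂^ξ_{μ′}∂^{ξ*}_μC^ξ)(N·k − w)`.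
[cite: Balaban1983Higgs3, (3.26) p.440] -/
theorem sumB_unfold (hd : P.d = 3) (hξ : 0 < ξ) (hξ1 : ξ ≤ 1) (hN : 1 ≤ ξ * (P.sitesPerDir j : ℝ)) (μ μ' : Fin P.d)
    (y : Site P j) :
    ∑ x' : Site P j, CxiT ξ y x' * d2Kernel ξ⁻¹ μ' μ (CxiT ξ) x' y =
      ∑' k : ZSite P.d, ∑' w : ZSite P.d,
        Cxi P.d ξ w * pdiffZ ξ⁻¹ μ' (pdiffAdjZ ξ⁻¹ μ (Cxi P.d ξ)) ((P.sitesPerDir j : ℤ) • k - w) := by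
  have hS := summable_pair_family hd hξ hξ1 hN (by norm_num) (by positivity : (0 : ℝ) ≤ 11700 * ξ⁻¹) (by norm_num : 1 ≤ 2)
    le_rfl _ _ (abs_Cxi_le_profile hd hξ hξ1) (abs_d2Z_Cxi_le_crude hd hξ hξ1 μ' μ)
  simp_rw [CxiT_eq_tsum ξ y, d2Kernel_CxiT_eq_tsum hξ]
  exact sum_tsum_cosetPt_mul_eq_one y _ _ (summable_signed hS)

/-! ## §2 The `k = 0` term is the infinite-lattice function of (3.29) -/

/-- **The `k = 0` term IS p20's `Pi2Z … 0`**: the infinite-lattice self-energy function `Π^{(ξ)}_{μμ′}(0)` of the square bracket of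
(3.29) (`B3Eq329WardVanishing.Pi2Z`, all propagators `C^ξ`) written with the `k = 0` sections of the unfolded graph sums (reindexing
`y′ = −w`). [cite: Balaban1983Higgs3, (3.29) p.441] -/
theorem Pi2Z_zero_eq (hd : P.d = 3) (hξ : 0 < ξ) (hξ1 : ξ ≤ 1) (τ : ℝ) (μ μ' : Fin P.d) :
    Pi2Z P.d ξ τ (Cxi P.d ξ) μ μ' 0 =
      τ * (ξ ^ P.d * (-(∑' w : ZSite P.d, pdiffAdjZ ξ⁻¹ μ' (Cxi P.d ξ) w * pdiffAdjZ ξ⁻¹ μ (Cxi P.d ξ) (-w)) +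
        ∑' w : ZSite P.d, Cxi P.d ξ w * pdiffZ ξ⁻¹ μ' (pdiffAdjZ ξ⁻¹ μ (Cxi P.d ξ)) (-w)))
      - (if μ = μ' then τ * Cxi P.d ξ 0 else 0)
      - (if μ = μ' then τ * (ξ * pdiffAdjZ ξ⁻¹ μ (Cxi P.d ξ) 0) else 0) := by
  set C := Cxi P.d ξ with hC
  set A := pdiffAdjZ ξ⁻¹ μ C with hA
  set A' := pdiffAdjZ ξ⁻¹ μ' C with hA'
  set E := pdiffZ ξ⁻¹ μ' (pdiffAdjZ ξ⁻¹ μ C) with hE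
  -- summability of the two k = 0 sections (far-point lemma at v = 0, R = 0)
  have hz : 2 * (0 : ℝ) ≤ (supNorm (0 : ZSite P.d) : ℝ) := by rw [supNorm_zero]; norm_num
  have hsA := (pair_far_bound hd hξ hξ1 (by norm_num) (by norm_num) le_rfl le_rfl A' A
    (abs_pdiffAdjZ_Cxi_le_profile hd hξ hξ1 μ') (abs_pdiffAdjZ_Cxi_le_profile hd hξ hξ1 μ) 0 hz).1
  have hsB := (pair_far_bound hd hξ hξ1 (by norm_num) (by positivity : (0 : ℝ) ≤ 11700 * ξ⁻¹) (by norm_num : 1 ≤ 2)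
    le_rfl C E (abs_Cxi_le_profile hd hξ hξ1) (abs_d2Z_Cxi_le_crude hd hξ hξ1 μ' μ) 0 hz).1
  simp only [zero_sub] at hsA hsB
  have h1 : Summable fun w : ZSite P.d => A' w * A (-w) := Summable.of_abs (hsA.congr fun w => by rw [← abs_mul])
  have h2 : Summable fun w : ZSite P.d => C w * E (-w) := Summable.of_abs (hsB.congr fun w => by rw [← abs_mul])
  have hsum : ∑' y' : ZSite P.d, ξ ^ P.d * (-(A' (0 - y') * A (y' - 0)) + C (0 - y') * E (y' - 0)) =
      ξ ^ P.d * (-(∑' w, A' w * A (-w)) + ∑' w, C w * E (-w)) := by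
    rw [← (Equiv.neg (ZSite P.d)).tsum_eq]
    simp only [Equiv.neg_apply, zero_sub, sub_zero, neg_neg]
    rw [tsum_mul_left, (h1.neg).tsum_add h2, tsum_neg]
  unfold Pi2Z
  rw [hsum]

/-! ## §3 The four period-shift families: summability and decay -/

section Families

/-- kernel: `|N·k|_∞ = N|k|_∞` in `ℝ`. [cite: Balaban1983Higgs3, (3.27) p.441] -/
private theorem supNorm_shift_cast (k : ZSite P.d) :
    (supNorm ((P.sitesPerDir j : ℤ) • k) : ℝ) = (P.sitesPerDir j : ℝ) * (supNorm k : ℝ) := by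
  rw [supNorm_smul]; push_cast; ring

/-- kernel: `0 < N` and `0 < a = ξN/4`, `1/4 ≤ a`. [cite: Balaban1983Higgs3, (3.27) p.441] -/
private theorem rate_pos (hξ : 0 < ξ) (hN : 1 ≤ ξ * (P.sitesPerDir j : ℝ)) : (0 : ℝ) < P.sitesPerDir j ∧ 0 < ξ * (P.sitesPerDir j : ℝ) / 4 ∧
    1 / 4 ≤ ξ * (P.sitesPerDir j : ℝ) / 4 := by
  have hNpos : (0 : ℝ) < P.sitesPerDir j := by exact_mod_cast Nat.pos_of_ne_zero (P.sitesPerDir_ne_zero j)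
  exact ⟨hNpos, by positivity, by linarith⟩

/-- kernel: at a period shift every profile is `≤ ξ⁻²·e^{−a|k|_∞}` (all `k`) — the summable majorant in `k`.
[cite: Balaban1983Higgs3, (3.27) p.441] -/
private theorem profile_shift_all (hξ : 0 < ξ) (hξ1 : ξ ≤ 1) (hN : 1 ≤ ξ * (P.sitesPerDir j : ℝ)) (k : ZSite P.d)
    (q : ℕ) (hq : q ≤ 2) :
    ((ξ * max 1 (supNorm ((P.sitesPerDir j : ℤ) • k) : ℝ)) ^ q)⁻¹ *
        Real.exp (-(1 / 2 * (ξ * (supNorm ((P.sitesPerDir j : ℤ) • k) : ℝ)))) ≤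
      (ξ ^ 2)⁻¹ * Real.exp (-(ξ * (P.sitesPerDir j : ℝ) / 4 * (supNorm k : ℝ))) := by
  obtain ⟨hNpos, -, -⟩ := rate_pos hξ hN
  have h1 : ((ξ * max 1 (supNorm ((P.sitesPerDir j : ℤ) • k) : ℝ)) ^ q)⁻¹ ≤ (ξ ^ 2)⁻¹ := by
    refine inv_anti₀ (pow_pos hξ 2) ?_
    calc ξ ^ 2 ≤ ξ ^ q := pow_le_pow_of_le_one hξ.le hξ1 hq
      _ ≤ (ξ * max 1 (supNorm ((P.sitesPerDir j : ℤ) • k) : ℝ)) ^ q :=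
          pow_le_pow_left₀ hξ.le (le_mul_of_one_le_right hξ.le (le_max_left _ _)) q
  have h2 : Real.exp (-(1 / 2 * (ξ * (supNorm ((P.sitesPerDir j : ℤ) • k) : ℝ)))) ≤
      Real.exp (-(ξ * (P.sitesPerDir j : ℝ) / 4 * (supNorm k : ℝ))) := by
    rw [supNorm_shift_cast]
    refine Real.exp_le_exp.2 ?_
    have : 0 ≤ ξ * (P.sitesPerDir j : ℝ) * (supNorm k : ℝ) := by positivity
    nlinarith
  exact mul_le_mul h1 h2 (Real.exp_pos _).le (by positivity)

/-- kernel: at a NON-ZERO period shift every profile is `≤ e^{−a|k|_∞}` (`ξ·max(1,N|k|_∞) ≥ ξN ≥ 1`).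
[cite: Balaban1983Higgs3, (3.27) p.441] -/
private theorem profile_shift_ne_zero (hξ : 0 < ξ) (hN : 1 ≤ ξ * (P.sitesPerDir j : ℝ)) (k : ZSite P.d) (hk : k ≠ 0)
    (q : ℕ) :
    ((ξ * max 1 (supNorm ((P.sitesPerDir j : ℤ) • k) : ℝ)) ^ q)⁻¹ *
        Real.exp (-(1 / 2 * (ξ * (supNorm ((P.sitesPerDir j : ℤ) • k) : ℝ)))) ≤
      Real.exp (-(ξ * (P.sitesPerDir j : ℝ) / 4 * (supNorm k : ℝ))) := by
  obtain ⟨hNpos, -, -⟩ := rate_pos hξ hN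
  have hk1 : (1 : ℝ) ≤ supNorm k := by exact_mod_cast one_le_supNorm hk
  have h1 : ((ξ * max 1 (supNorm ((P.sitesPerDir j : ℤ) • k) : ℝ)) ^ q)⁻¹ ≤ 1 := by
    refine inv_le_one_of_one_le₀ (one_le_pow₀ ?_)
    rw [supNorm_shift_cast]
    calc (1 : ℝ) ≤ ξ * P.sitesPerDir j := hN
      _ ≤ ξ * (P.sitesPerDir j * supNorm k) := by nlinarith
      _ ≤ ξ * max 1 ((P.sitesPerDir j : ℝ) * (supNorm k : ℝ)) := mul_le_mul_of_nonneg_left (le_max_right _ _) hξ.le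
  have h2 : Real.exp (-(1 / 2 * (ξ * (supNorm ((P.sitesPerDir j : ℤ) • k) : ℝ)))) ≤
      Real.exp (-(ξ * (P.sitesPerDir j : ℝ) / 4 * (supNorm k : ℝ))) := by
    rw [supNorm_shift_cast]
    refine Real.exp_le_exp.2 ?_
    have : 0 ≤ ξ * (P.sitesPerDir j : ℝ) * (supNorm k : ℝ) := by positivity
    nlinarith
  calc _ ≤ 1 * Real.exp (-(ξ * (P.sitesPerDir j : ℝ) / 4 * (supNorm k : ℝ))) :=
        mul_le_mul h1 h2 (Real.exp_pos _).le zero_le_one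
    _ = _ := one_mul _

/-- kernel: `|Σ'_w f(w)g(N·k − w)| ≤ Σ'_w |f(w)||g(N·k − w)|`. [cite: Balaban1983Higgs3, (3.27) p.441] -/
private theorem abs_tsum_pair_le (f g : ZSite P.d → ℝ) (k : ZSite P.d)
    (hs : Summable fun w => |f w| * |g ((P.sitesPerDir j : ℤ) • k - w)|) :
    |∑' w, f w * g ((P.sitesPerDir j : ℤ) • k - w)| ≤ ∑' w, |f w| * |g ((P.sitesPerDir j : ℤ) • k - w)| := by
  have hs' : Summable fun w => ‖f w * g ((P.sitesPerDir j : ℤ) • k - w)‖ :=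
    hs.congr fun w => by rw [Real.norm_eq_abs, abs_mul]
  calc |∑' w, f w * g ((P.sitesPerDir j : ℤ) • k - w)| = ‖∑' w, f w * g ((P.sitesPerDir j : ℤ) • k - w)‖ :=
        (Real.norm_eq_abs _).symm
    _ ≤ ∑' w, ‖f w * g ((P.sitesPerDir j : ℤ) • k - w)‖ := norm_tsum_le_tsum_norm hs'
    _ = _ := tsum_congr fun w => by rw [Real.norm_eq_abs, abs_mul]

/-- **A pair family over the period shifts is summable in `k` and its non-zero shifts decay**: for kernels with all-sites profile
bounds, `k ↦ Σ'_w f(w)g(N·k − w)` is summable and `|Σ'_w f(w)g(N·k − w)| ≤ ξ⁻³·53312·c_f c_g·e^{−ξN|k|_∞/4}` for `k ≠ 0`.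
[cite: Balaban1983Higgs3, (3.27) p.441] -/
theorem pair_shift_summable_and_decay (hd : P.d = 3) (hξ : 0 < ξ) (hξ1 : ξ ≤ 1) (hN : 1 ≤ ξ * (P.sitesPerDir j : ℝ))
    {cf cg : ℝ} (hcf : 0 ≤ cf) (hcg : 0 ≤ cg) {p q : ℕ} (hp : p ≤ 2) (hq : q ≤ 2) (f g : ZSite P.d → ℝ)
    (hf : ∀ u, |f u| ≤ cf * (((ξ * max 1 (supNorm u : ℝ)) ^ p)⁻¹ * Real.exp (-(1 / 2 * (ξ * (supNorm u : ℝ))))))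
    (hg : ∀ u, |g u| ≤ cg * (((ξ * max 1 (supNorm u : ℝ)) ^ q)⁻¹ * Real.exp (-(1 / 2 * (ξ * (supNorm u : ℝ)))))) :
    Summable (fun k : ZSite P.d => ∑' w, f w * g ((P.sitesPerDir j : ℤ) • k - w)) ∧
      ∀ k : ZSite P.d, k ≠ 0 → |∑' w, f w * g ((P.sitesPerDir j : ℤ) • k - w)| ≤
        (ξ ^ 3)⁻¹ * (53312 * (cf * cg)) * Real.exp (-(ξ * (P.sitesPerDir j : ℝ) / 4 * (supNorm k : ℝ))) := by
  obtain ⟨-, ha0, -⟩ := rate_pos hξ hN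
  have hξ3 : (0 : ℝ) < ξ ^ 3 := pow_pos hξ 3
  have PF := fun k => pair_shift_bound hd hξ hξ1 hN hcf hcg hp hq f g hf hg k
  refine ⟨?_, fun k hk => ?_⟩
  · refine Summable.of_norm_bounded (((tsum_exp_supNorm_le hd ha0).1).mul_left
      ((ξ ^ 3)⁻¹ * (13328 * (cf * cg) * (ξ ^ 2)⁻¹))) fun k => ?_
    rw [Real.norm_eq_abs]
    calc |∑' w, f w * g ((P.sitesPerDir j : ℤ) • k - w)| ≤ ∑' w, |f w| * |g ((P.sitesPerDir j : ℤ) • k - w)| :=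
          abs_tsum_pair_le f g k (PF k).1
      _ = (ξ ^ 3)⁻¹ * (ξ ^ 3 * ∑' w, |f w| * |g ((P.sitesPerDir j : ℤ) • k - w)|) := by
          rw [← mul_assoc, inv_mul_cancel₀ hξ3.ne', one_mul]
      _ ≤ (ξ ^ 3)⁻¹ * (13328 * (cf * cg) * (ξ ^ 2)⁻¹ *
            Real.exp (-(ξ * (P.sitesPerDir j : ℝ) / 4 * (supNorm k : ℝ)))) :=
          mul_le_mul_of_nonneg_left (PF k).2.1 (inv_pos.2 hξ3).le
      _ = _ := by ring
  · calc |∑' w, f w * g ((P.sitesPerDir j : ℤ) • k - w)| ≤ ∑' w, |f w| * |g ((P.sitesPerDir j : ℤ) • k - w)| :=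
          abs_tsum_pair_le f g k (PF k).1
      _ = (ξ ^ 3)⁻¹ * (ξ ^ 3 * ∑' w, |f w| * |g ((P.sitesPerDir j : ℤ) • k - w)|) := by
          rw [← mul_assoc, inv_mul_cancel₀ hξ3.ne', one_mul]
      _ ≤ (ξ ^ 3)⁻¹ * (53312 * (cf * cg) * Real.exp (-(ξ * (P.sitesPerDir j : ℝ) / 4 * (supNorm k : ℝ)))) :=
          mul_le_mul_of_nonneg_left ((PF k).2.2 hk) (inv_pos.2 hξ3).le
      _ = _ := by ring

/-- **A local (one-kernel) family over the period shifts is summable and decays**: `k ↦ f(N·k)` is summable and `|f(N·k)| ≤ c_f·e^{−ξN|k|_∞/4}`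
for `k ≠ 0`. [cite: Balaban1983Higgs3, (3.27) p.441] -/
theorem local_shift_summable_and_decay (hd : P.d = 3) (hξ : 0 < ξ) (hξ1 : ξ ≤ 1) (hN : 1 ≤ ξ * (P.sitesPerDir j : ℝ))
    {cf : ℝ} (hcf : 0 ≤ cf) {p : ℕ} (hp : p ≤ 2) (f : ZSite P.d → ℝ)
    (hf : ∀ u, |f u| ≤ cf * (((ξ * max 1 (supNorm u : ℝ)) ^ p)⁻¹ * Real.exp (-(1 / 2 * (ξ * (supNorm u : ℝ)))))) :
    Summable (fun k : ZSite P.d => f ((P.sitesPerDir j : ℤ) • k)) ∧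
      ∀ k : ZSite P.d, k ≠ 0 → |f ((P.sitesPerDir j : ℤ) • k)| ≤
        cf * Real.exp (-(ξ * (P.sitesPerDir j : ℝ) / 4 * (supNorm k : ℝ))) := by
  obtain ⟨-, ha0, -⟩ := rate_pos hξ hN
  refine ⟨?_, fun k hk => (hf _).trans (mul_le_mul_of_nonneg_left (profile_shift_ne_zero hξ hN k hk p) hcf)⟩
  refine Summable.of_norm_bounded (((tsum_exp_supNorm_le hd ha0).1).mul_left (cf * (ξ ^ 2)⁻¹)) fun k => ?_
  rw [Real.norm_eq_abs]
  calc |f ((P.sitesPerDir j : ℤ) • k)| ≤ cf * _ := hf _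
    _ ≤ cf * ((ξ ^ 2)⁻¹ * Real.exp (-(ξ * (P.sitesPerDir j : ℝ) / 4 * (supNorm k : ℝ)))) :=
        mul_le_mul_of_nonneg_left (profile_shift_all hξ hξ1 hN k p hp) hcf
    _ = _ := by ring

/-! ## §4 The finite-volume defect of the Ward–Takahashi vanishing -/

/-- **`Π_{μμ′}[C^ξ_T]` as the sum over the period shifts** of the four unfolded families (the two graphs and the two local terms of the
square bracket of (3.26)). [cite: Balaban1983Higgs3, (3.26) p.440] -/
theorem Pi2_CxiT_eq_tsum (hd : P.d = 3) (hξ : 0 < ξ) (hξ1 : ξ ≤ 1) (hN : 1 ≤ ξ * (P.sitesPerDir j : ℝ)) (τ : ℝ)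
    (μ μ' : Fin P.d) (y : Site P j) :
    Pi2 ξ τ (CxiT ξ) (CxiT ξ) (CxiT ξ) μ μ' y =
      ξ ^ P.d * (-(τ * ∑' k : ZSite P.d, ∑' w : ZSite P.d,
          pdiffAdjZ ξ⁻¹ μ' (Cxi P.d ξ) w * pdiffAdjZ ξ⁻¹ μ (Cxi P.d ξ) ((P.sitesPerDir j : ℤ) • k - w)) +
        τ * ∑' k : ZSite P.d, ∑' w : ZSite P.d,
          Cxi P.d ξ w * pdiffZ ξ⁻¹ μ' (pdiffAdjZ ξ⁻¹ μ (Cxi P.d ξ)) ((P.sitesPerDir j : ℤ) • k - w))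
      - (if μ = μ' then τ * ∑' k : ZSite P.d, Cxi P.d ξ ((P.sitesPerDir j : ℤ) • k) else 0)
      - (if μ = μ' then τ * (ξ * ∑' k : ZSite P.d, pdiffAdjZ ξ⁻¹ μ (Cxi P.d ξ) ((P.sitesPerDir j : ℤ) • k)) else 0) := by
  have hker : ∀ x', ξ ^ P.d * kerC ξ τ (CxiT ξ) (CxiT ξ) μ μ' y x' =
      -(ξ ^ P.d * τ) * (dAdjKernel ξ⁻¹ μ' (CxiT ξ) y x' * dAdjKernel ξ⁻¹ μ (CxiT ξ) x' y) +
        ξ ^ P.d * τ * (CxiT ξ y x' * d2Kernel ξ⁻¹ μ' μ (CxiT ξ) x' y) := by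
    intro x'; simp only [kerC, kerA, kerB]; ring
  have hsum : ∑ x' : Site P j, ξ ^ P.d * kerC ξ τ (CxiT ξ) (CxiT ξ) μ μ' y x' =
      ξ ^ P.d * (-(τ * ∑' k : ZSite P.d, ∑' w : ZSite P.d,
          pdiffAdjZ ξ⁻¹ μ' (Cxi P.d ξ) w * pdiffAdjZ ξ⁻¹ μ (Cxi P.d ξ) ((P.sitesPerDir j : ℤ) • k - w)) +
        τ * ∑' k : ZSite P.d, ∑' w : ZSite P.d,
          Cxi P.d ξ w * pdiffZ ξ⁻¹ μ' (pdiffAdjZ ξ⁻¹ μ (Cxi P.d ξ)) ((P.sitesPerDir j : ℤ) • k - w)) := by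
    rw [Finset.sum_congr rfl fun x' _ => hker x', Finset.sum_add_distrib, ← Finset.mul_sum, ← Finset.mul_sum,
      sumA_unfold hd hξ hξ1 hN μ μ' y, sumB_unfold hd hξ hξ1 hN μ μ' y]
    ring
  unfold Pi2
  rw [hsum, CxiT_diag_eq_tsum ξ y, dAdjKernel_CxiT_diag_eq_tsum hξ μ y]

/-- kernel: the `k = 0` term of `Π_{μμ′}[C^ξ_T]` VANISHES — it is p20's `Pi2Z 3 ξ τ C^ξ μ μ′ 0 = 0` (the Ward–Takahashi vanishing on
the infinite lattice). [cite: Balaban1983Higgs3, (3.29) p.442] -/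
theorem zero_shift_term_eq_zero (hd : P.d = 3) (hξ : 0 < ξ) (hξ1 : ξ ≤ 1) (τ : ℝ) (μ μ' : Fin P.d) :
    ξ ^ P.d * (-(τ * ∑' w : ZSite P.d,
          pdiffAdjZ ξ⁻¹ μ' (Cxi P.d ξ) w * pdiffAdjZ ξ⁻¹ μ (Cxi P.d ξ) ((P.sitesPerDir j : ℤ) • (0 : ZSite P.d) - w)) +
        τ * ∑' w : ZSite P.d,
          Cxi P.d ξ w * pdiffZ ξ⁻¹ μ' (pdiffAdjZ ξ⁻¹ μ (Cxi P.d ξ)) ((P.sitesPerDir j : ℤ) • (0 : ZSite P.d) - w))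
      - (if μ = μ' then τ * Cxi P.d ξ ((P.sitesPerDir j : ℤ) • (0 : ZSite P.d)) else 0)
      - (if μ = μ' then τ * (ξ * pdiffAdjZ ξ⁻¹ μ (Cxi P.d ξ) ((P.sitesPerDir j : ℤ) • (0 : ZSite P.d))) else 0) = 0 := by
  simp only [smul_zero, zero_sub]
  have h := Pi2Z_zero_eq hd hξ hξ1 τ μ μ'
  rw [Pi2Z_Cxi_eq_zero hξ τ μ μ' 0] at h
  rw [show ξ ^ P.d * (-(τ * ∑' w : ZSite P.d, pdiffAdjZ ξ⁻¹ μ' (Cxi P.d ξ) w * pdiffAdjZ ξ⁻¹ μ (Cxi P.d ξ) (-w)) +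
      τ * ∑' w : ZSite P.d, Cxi P.d ξ w * pdiffZ ξ⁻¹ μ' (pdiffAdjZ ξ⁻¹ μ (Cxi P.d ξ)) (-w)) =
    τ * (ξ ^ P.d * (-(∑' w : ZSite P.d, pdiffAdjZ ξ⁻¹ μ' (Cxi P.d ξ) w * pdiffAdjZ ξ⁻¹ μ (Cxi P.d ξ) (-w)) +
      ∑' w : ZSite P.d, Cxi P.d ξ w * pdiffZ ξ⁻¹ μ' (pdiffAdjZ ξ⁻¹ μ (Cxi P.d ξ)) (-w))) by ring]
  exact h.symm

/-- kernel: the tail of a period-shift family against the shell sums: if `|f(k)| ≤ b·e^{−a|k|_∞}` for `k ≠ 0` then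
`|Σ'_k [k ≠ 0]f(k)| ≤ b·Σ'_k [k ≠ 0]e^{−a|k|_∞}`. [cite: Balaban1983Higgs3, (3.27) p.441] -/
theorem abs_tsum_ite_le {d : ℕ} {f : ZSite d → ℝ} {a b : ℝ}
    (hea : Summable fun k : ZSite d => if k = 0 then (0 : ℝ) else Real.exp (-(a * (supNorm k : ℝ))))
    (hbound : ∀ k, k ≠ 0 → |f k| ≤ b * Real.exp (-(a * (supNorm k : ℝ)))) :
    |∑' k, (if k = 0 then 0 else f k)| ≤ b * ∑' k : ZSite d, (if k = 0 then (0 : ℝ) else Real.exp (-(a * (supNorm k : ℝ)))) := by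
  have habs : ∀ k : ZSite d, ‖(if k = 0 then 0 else f k)‖ = (if k = 0 then 0 else |f k|) := by
    intro k; split_ifs <;> simp [Real.norm_eq_abs]
  have hpt : ∀ k : ZSite d, (if k = 0 then 0 else |f k|) ≤ b * (if k = 0 then (0 : ℝ) else Real.exp (-(a * (supNorm k : ℝ)))) := by
    intro k
    split_ifs with hk
    · simp
    · exact hbound k hk
  have hmaj : Summable fun k : ZSite d => b * (if k = 0 then (0 : ℝ) else Real.exp (-(a * (supNorm k : ℝ)))) :=
    hea.mul_left b
  have hs : Summable fun k : ZSite d => (if k = 0 then 0 else |f k|) :=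
    Summable.of_nonneg_of_le (fun k => by split_ifs <;> simp [abs_nonneg]) hpt hmaj
  have hs' : Summable fun k : ZSite d => ‖(if k = 0 then 0 else f k)‖ := hs.congr fun k => (habs k).symm
  calc |∑' k, (if k = 0 then 0 else f k)| = ‖∑' k, (if k = 0 then 0 else f k)‖ := (Real.norm_eq_abs _).symm
    _ ≤ ∑' k, ‖(if k = 0 then 0 else f k)‖ := norm_tsum_le_tsum_norm hs'
    _ = ∑' k, (if k = 0 then 0 else |f k|) := tsum_congr habs
    _ ≤ ∑' k, b * (if k = 0 then (0 : ℝ) else Real.exp (-(a * (supNorm k : ℝ)))) := hs.tsum_le_tsum hpt hmaj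
    _ = _ := tsum_mul_left

/-- kernel: `|if c then x else 0| ≤ |x|`. [folklore] -/
private theorem abs_ite_le (c : Prop) [Decidable c] (x : ℝ) : |(if c then x else 0)| ≤ |x| := by
  split_ifs <;> simp [abs_nonneg]

/-- **(A) THE FINITE-VOLUME DEFECT OF THE WARD–TAKAHASHI VANISHING.**  On the periodic ξ-lattice `T = Site P j` (`d = 3`, `N` sites per
direction) the self-energy function of the square bracket of (3.26)/(3.29) with ALL THREE propagators equal to the torus free propagator
`C^ξ_T` satisfies `|Π_{μμ′}[C^ξ_T, C^ξ_T, C^ξ_T](y)| ≤ 6·10¹⁵·|tr q²|·e^{−ξN/8}` for `0 < ξ ≤ 1`, `ξN ≥ 1`, every `y`, `μ`, `μ′` — it is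
NOT zero (p20's `B3Eq329TorusCounterexample`, G-B3-08) but exponentially small in the physical period `ξN`, uniformly in the spacing; its
infinite-lattice counterpart is EXACTLY zero (p. 442 *"… has exactly the form appearing in the Ward-Takahashi identity (2.26) with M² = 1,
hence it is equal to 0"*, p20's `Pi2Z_Cxi_eq_zero`), which is the `k = 0` term of the unfolded torus sum; the bound is the sum of the
`k ≠ 0` wrap-around terms. [cite: Balaban1983Higgs3, (3.29) p.442] -/
theorem abs_Pi2_CxiT_le (hd : P.d = 3) (hξ : 0 < ξ) (hξ1 : ξ ≤ 1) (hN : 1 ≤ ξ * (P.sitesPerDir j : ℝ)) (τ : ℝ)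
    (μ μ' : Fin P.d) (y : Site P j) :
    |Pi2 ξ τ (CxiT ξ) (CxiT ξ) (CxiT ξ) μ μ' y| ≤ 6 * 10 ^ 15 * |τ| * Real.exp (-(ξ * (P.sitesPerDir j : ℝ) / 8)) := by
  set N := P.sitesPerDir j with hNdef
  set C := Cxi P.d ξ with hC
  set A := pdiffAdjZ ξ⁻¹ μ C with hA
  set A' := pdiffAdjZ ξ⁻¹ μ' C with hA'
  set Ap := pdiffZ ξ⁻¹ μ' C with hAp
  set E := pdiffZ ξ⁻¹ μ' (pdiffAdjZ ξ⁻¹ μ C) with hE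
  set a : ℝ := ξ * N / 4 with ha
  obtain ⟨hNpos, ha0, ha4⟩ := rate_pos hξ hN
  have hξ3 : (0 : ℝ) < ξ ^ 3 := pow_pos hξ 3
  -- the profile bounds of the ξℤ³ kernels
  have hfC := abs_Cxi_le_profile hd hξ hξ1
  have hfA := abs_pdiffAdjZ_Cxi_le_profile hd hξ hξ1 μ
  have hfA' := abs_pdiffAdjZ_Cxi_le_profile hd hξ hξ1 μ'
  have hfAp := abs_pdiffZ_Cxi_le_profile hd hξ hξ1 μ'
  have hfE := abs_d2Z_Cxi_le_crude hd hξ hξ1 μ' μ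
  -- the four families
  set aK : ZSite P.d → ℝ := fun k => ∑' w, A' w * A ((N : ℤ) • k - w) with haK
  set bK : ZSite P.d → ℝ := fun k => ∑' w, C w * E ((N : ℤ) • k - w) with hbK
  set cK : ZSite P.d → ℝ := fun k => C ((N : ℤ) • k) with hcK
  set dK : ZSite P.d → ℝ := fun k => A ((N : ℤ) • k) with hdK
  obtain ⟨haKs, hB1⟩ := pair_shift_summable_and_decay hd hξ hξ1 hN (by norm_num) (by norm_num) le_rfl le_rfl A' A hfA' hfA
  obtain ⟨hbKs, -⟩ := pair_shift_summable_and_decay hd hξ hξ1 hN (by norm_num)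
    (by positivity : (0 : ℝ) ≤ 11700 * ξ⁻¹) (by norm_num : 1 ≤ 2) le_rfl C E hfC hfE
  obtain ⟨-, hB2'⟩ := pair_shift_summable_and_decay hd hξ hξ1 hN (by norm_num) (by norm_num) le_rfl le_rfl Ap A hfAp hfA
  obtain ⟨hcKs, hB3⟩ := local_shift_summable_and_decay hd hξ hξ1 hN (by norm_num) (by norm_num : 1 ≤ 2) C hfC
  obtain ⟨hdKs, hB4⟩ := local_shift_summable_and_decay hd hξ hξ1 hN (by norm_num) le_rfl A hfA
  -- the second graph by parts, for the decay of its non-zero shifts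
  have hB2 : ∀ k : ZSite P.d, k ≠ 0 → |bK k| ≤ (ξ ^ 3)⁻¹ * (53312 * (900 * 900)) * Real.exp (-(a * (supNorm k : ℝ))) := by
    intro k hk
    have hparts : bK k = ∑' w, Ap w * A ((N : ℤ) • k - w) := tsum_Cxi_mul_d2_eq hd hξ hξ1 hN μ' μ k
    rw [hparts, ha]
    exact hB2' k hk
  obtain ⟨-, hExpIte, hIte⟩ := tsum_exp_supNorm_le hd ha0
  -- (1) Π over the period shifts, (2) the k = 0 term removed
  rw [Pi2_CxiT_eq_tsum hd hξ hξ1 hN τ μ μ' y, haKs.tsum_eq_add_tsum_ite 0, hbKs.tsum_eq_add_tsum_ite 0,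
    hcKs.tsum_eq_add_tsum_ite 0, hdKs.tsum_eq_add_tsum_ite 0]
  have hzero := zero_shift_term_eq_zero (j := j) hd hξ hξ1 τ μ μ'
  have hsplit : ξ ^ P.d * (-(τ * (aK 0 + ∑' k, if k = 0 then 0 else aK k)) + τ * (bK 0 + ∑' k, if k = 0 then 0 else bK k)) -
      (if μ = μ' then τ * (cK 0 + ∑' k, if k = 0 then 0 else cK k) else 0) -
      (if μ = μ' then τ * (ξ * (dK 0 + ∑' k, if k = 0 then 0 else dK k)) else 0) =
      (ξ ^ P.d * (-(τ * aK 0) + τ * bK 0) - (if μ = μ' then τ * cK 0 else 0) - (if μ = μ' then τ * (ξ * dK 0) else 0)) +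
      (ξ ^ P.d * (-(τ * ∑' k, if k = 0 then 0 else aK k) + τ * ∑' k, if k = 0 then 0 else bK k) -
        (if μ = μ' then τ * ∑' k, (if k = 0 then 0 else cK k) else 0) -
        (if μ = μ' then τ * (ξ * ∑' k, (if k = 0 then 0 else dK k)) else 0)) := by
    split_ifs <;> ring
  have hξP : ξ ^ P.d = ξ ^ 3 := by rw [hd]
  rw [hsplit, hzero, zero_add, hξP]
  -- (3) the wrap-around tails
  set S : ℝ := ∑' k : ZSite P.d, (if k = 0 then (0 : ℝ) else Real.exp (-(a * (supNorm k : ℝ)))) with hS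
  have hS0 : 0 ≤ S := tsum_nonneg fun k => by split_ifs <;> positivity
  have hT1 := abs_tsum_ite_le hExpIte hB1
  have hT2 := abs_tsum_ite_le hExpIte hB2
  have hT3 := abs_tsum_ite_le hExpIte hB3
  have hT4 := abs_tsum_ite_le hExpIte hB4
  have hSle : S ≤ 59904 * Real.exp (-(ξ * (N : ℝ) / 8)) := by
    refine hIte.trans ?_
    have h1 : 416 / a ^ 2 ≤ 6656 := by
      rw [div_le_iff₀ (by positivity)]; nlinarith
    have h2 : 1 + 2 / a ≤ 9 := by
      have : 2 / a ≤ 8 := by rw [div_le_iff₀ ha0]; linarith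
      linarith
    have h3 : Real.exp (-(a / 2)) = Real.exp (-(ξ * (N : ℝ) / 8)) := by rw [ha]; ring_nf
    rw [h3]
    have hE := Real.exp_pos (-(ξ * (N : ℝ) / 8))
    calc 416 / a ^ 2 * (1 + 2 / a) * Real.exp (-(ξ * (N : ℝ) / 8)) ≤ 6656 * 9 * Real.exp (-(ξ * (N : ℝ) / 8)) := by
          gcongr
      _ = _ := by norm_num
  have hτ := abs_nonneg τ
  -- the four pieces
  have p1 : |ξ ^ 3 * (-(τ * ∑' k, if k = 0 then 0 else aK k) + τ * ∑' k, if k = 0 then 0 else bK k)| ≤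
      |τ| * (53312 * (900 * 900)) * S + |τ| * (53312 * (900 * 900)) * S := by
    rw [abs_mul, abs_of_pos hξ3]
    have e1 : ξ ^ 3 * (|τ| * ((ξ ^ 3)⁻¹ * (53312 * (900 * 900)) * S)) = |τ| * (53312 * (900 * 900)) * S := by
      field_simp
    calc ξ ^ 3 * |-(τ * ∑' k, if k = 0 then 0 else aK k) + τ * ∑' k, if k = 0 then 0 else bK k|
        ≤ ξ ^ 3 * (|τ| * |∑' k, if k = 0 then 0 else aK k| + |τ| * |∑' k, if k = 0 then 0 else bK k|) := by
          refine mul_le_mul_of_nonneg_left ((abs_add_le _ _).trans (le_of_eq ?_)) hξ3.le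
          rw [abs_neg, abs_mul, abs_mul]
      _ ≤ ξ ^ 3 * (|τ| * ((ξ ^ 3)⁻¹ * (53312 * (900 * 900)) * S) + |τ| * ((ξ ^ 3)⁻¹ * (53312 * (900 * 900)) * S)) :=
          mul_le_mul_of_nonneg_left (add_le_add (mul_le_mul_of_nonneg_left hT1 hτ) (mul_le_mul_of_nonneg_left hT2 hτ)) hξ3.le
      _ = _ := by rw [mul_add, e1]
  have p3 : |(if μ = μ' then τ * ∑' k, (if k = 0 then 0 else cK k) else 0)| ≤ |τ| * (140 * S) := by
    refine (abs_ite_le _ _).trans ?_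
    rw [abs_mul]
    exact mul_le_mul_of_nonneg_left hT3 hτ
  have p4 : |(if μ = μ' then τ * (ξ * ∑' k, (if k = 0 then 0 else dK k)) else 0)| ≤ |τ| * (900 * S) := by
    refine (abs_ite_le _ _).trans ?_
    rw [abs_mul, abs_mul, abs_of_pos hξ]
    refine mul_le_mul_of_nonneg_left ?_ hτ
    calc ξ * |∑' k, if k = 0 then 0 else dK k| ≤ 1 * (900 * S) := mul_le_mul hξ1 hT4 (abs_nonneg _) zero_le_one
      _ = 900 * S := one_mul _
  calc |ξ ^ 3 * (-(τ * ∑' k, if k = 0 then 0 else aK k) + τ * ∑' k, if k = 0 then 0 else bK k) -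
        (if μ = μ' then τ * ∑' k, (if k = 0 then 0 else cK k) else 0) -
        (if μ = μ' then τ * (ξ * ∑' k, (if k = 0 then 0 else dK k)) else 0)|
      ≤ |ξ ^ 3 * (-(τ * ∑' k, if k = 0 then 0 else aK k) + τ * ∑' k, if k = 0 then 0 else bK k)| +
        |(if μ = μ' then τ * ∑' k, (if k = 0 then 0 else cK k) else 0)| +
        |(if μ = μ' then τ * (ξ * ∑' k, (if k = 0 then 0 else dK k)) else 0)| :=
        (abs_sub _ _).trans (add_le_add (abs_sub _ _) le_rfl)
    _ ≤ (|τ| * (53312 * (900 * 900)) * S + |τ| * (53312 * (900 * 900)) * S) + |τ| * (140 * S) + |τ| * (900 * S) :=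
        add_le_add (add_le_add p1 p3) p4
    _ = 86365441040 * |τ| * S := by ring
    _ ≤ 86365441040 * |τ| * (59904 * Real.exp (-(ξ * (N : ℝ) / 8))) :=
        mul_le_mul_of_nonneg_left hSle (by positivity)
    _ ≤ 6 * 10 ^ 15 * |τ| * Real.exp (-(ξ * (N : ℝ) / 8)) := by
        have hE := (Real.exp_pos (-(ξ * (N : ℝ) / 8))).le
        nlinarith [mul_nonneg hτ hE]

end Families

/-! ## §5 The coefficient at the vertex `Π_{μμ′}` for the model propagator -/

/-- **(B) THE RESCALED COEFFICIENT AT THE VERTEX `Π_{μμ′}` IS BOUNDED** — p. 442, *"the coefficient at the vertex [Π_{μμ′}] is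
proportional to (L^{j₀}η)^{−d+2}"*, at the zero-field torus instance: for odd `L > 1`, `a > 0`, `m² ≥ 0` there is `Cst` (a function of
`L, a, m²`) such that for EVERY `P = (3, L, m, K)`, `1 ≤ k ≤ K`, `τ = tr q²`, `μ, μ′, y`:
`|Π_{μμ′}[G^ξ_k(0), G^ξ_k(0), G^ξ_k(0)](y)| ≤ Cst·|tr q²|` on the `ξ = L^{−k}` lattice (`G^ξ_k(0)` = `B3GkZeroTorusRescaled.G0xi`, the
rescaled zero-field torus propagator of the print's `G_{j₀}(0)`), uniformly in the volume and the scale.  By r15's PROVED rescaling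
`B3Sect3VectorSelfEnergy.Pi2_rescale` the η-lattice coefficient `Π^{(η,j₀)}_{μμ′}` is this bounded function times `(L^{j₀}η)^{−d+2} =
(L^{j₀}η)^{−1}`.  Assembly of seat p39 gen 7's `B3Pi2CrossTermsZeroTorus.Pi2_G0xi_sub_CxiT` (the graphs with at least one
`G(0)(1 − m² − aP)C^ξ` factor are convergent) and (A) `abs_Pi2_CxiT_le` (the pure-`C^ξ_T` function is the exponentially small
finite-volume defect of the Ward–Takahashi vanishing). [cite: Balaban1983Higgs3, (3.30) p.442] -/
theorem abs_Pi2_G0xi_le (L : ℕ) (hL : Odd L ∧ 1 < L) {a : ℝ} (ha : 0 < a) {msq : ℝ} (hmsq : 0 ≤ msq) :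
    ∃ Cst : ℝ, 0 < Cst ∧ ∀ (P : Params), P.d = 3 → P.L = L → ∀ k : ℕ, 1 ≤ k → k ≤ P.K →
      ∀ (τ : ℝ) (μ μ' : Fin P.d) (y : Site P 0),
        |Pi2 (P.eta k) τ (B3GkZeroTorusRescaled.G0xi P a msq k) (B3GkZeroTorusRescaled.G0xi P a msq k)
          (B3GkZeroTorusRescaled.G0xi P a msq k) μ μ' y| ≤ Cst * |τ| := by
  obtain ⟨Cst, hCst, H⟩ := B3Pi2CrossTermsZeroTorus.Pi2_G0xi_sub_CxiT L hL ha hmsq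
  refine ⟨Cst + 6 * 10 ^ 15, by positivity, fun P hPd hPL k hk1 hkK τ μ μ' y => ?_⟩
  have h1 := H P hPd hPL k hk1 hkK τ μ μ' y
  have hkm : k ≤ P.m + P.K := hkK.trans (Nat.le_add_left _ _)
  have hη : 0 < P.eta k := B3GkZeroTorusRescaled.eta_pos P k
  have hη1 : P.eta k ≤ 1 := B3GkZeroTorusRescaled.eta_le_one P k
  have hN : 1 ≤ P.eta k * (P.sitesPerDir 0 : ℝ) := B3GkZeroTorusRescaled.one_le_eta_mul_sitesPerDir P hkm
  have h2 := abs_Pi2_CxiT_le hPd hη hη1 hN τ μ μ' y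
  have h0 : (0 : ℝ) ≤ P.eta k * (P.sitesPerDir 0 : ℝ) := by positivity
  have h3 : Real.exp (-(P.eta k * (P.sitesPerDir 0 : ℝ) / 8)) ≤ 1 := Real.exp_le_one_iff.2 (by linarith)
  have hτ := abs_nonneg τ
  set G := B3GkZeroTorusRescaled.G0xi P a msq k with hG
  calc |Pi2 (P.eta k) τ G G G μ μ' y|
      = |(Pi2 (P.eta k) τ G G G μ μ' y - Pi2 (P.eta k) τ (CxiT (P.eta k)) (CxiT (P.eta k)) (CxiT (P.eta k)) μ μ' y) +
          Pi2 (P.eta k) τ (CxiT (P.eta k)) (CxiT (P.eta k)) (CxiT (P.eta k)) μ μ' y| := by rw [sub_add_cancel]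
    _ ≤ |Pi2 (P.eta k) τ G G G μ μ' y - Pi2 (P.eta k) τ (CxiT (P.eta k)) (CxiT (P.eta k)) (CxiT (P.eta k)) μ μ' y| +
          |Pi2 (P.eta k) τ (CxiT (P.eta k)) (CxiT (P.eta k)) (CxiT (P.eta k)) μ μ' y| := abs_add_le _ _
    _ ≤ Cst * |τ| + 6 * 10 ^ 15 * |τ| * Real.exp (-(P.eta k * (P.sitesPerDir 0 : ℝ) / 8)) := add_le_add h1 h2
    _ ≤ Cst * |τ| + 6 * 10 ^ 15 * |τ| * 1 := by gcongr
    _ = (Cst + 6 * 10 ^ 15) * |τ| := by ring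

end

end Literature.MathematicalPhysics.QuantumFieldTheory.Balaban1983to89.B3Pi2CxiTorusBounded
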